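import Literature.AlgebraicGeometry.Frobenioids.QuasiTemperoidCosetGaloisDescent
import HarnessLib

/-!
# Frobenioids II, Theorem 2.4 (i), proof p. 20 ll. 9–22: «`Φ` fieldwise saturated ⟺ (a) ∧ (b)» UNCONDITIONALLY over
# the GENERAL printed base `D = B^temp(Π, Π°)⁰ → B^temp(G_{ℚ_p})⁰ → D₀` of §2 (Π tempered, `Π → G_{ℚ_p}` open)

Mochizuki, *The geometry of Frobenioids II*, Kyushu J. Math. **62** (2008) 401–460. The SETTING of §2, p. 17 ll. 1–9
[cite: MochizukiFrdII2008, §2 p.17]: "`D` is any category `B^temp(Π, Π°)⁰` as in Example 1.3, (iii), where `Π → Q`,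
`G_{ℚ_p} ↠ Q` [i.e., we take "`F`" of loc. cit. to be `ℚ_p`], `Π° ⊆ Π` are as in loc. cit., and we assume further that the
surjection `G_{ℚ_p} ↠ Q` is an isomorphism. Write `G := Im(Π) ⊆ Q` … `K` for the finite extension of `ℚ_p` determined
by the open subgroup `G ⊆ Q`"; Example 1.3 (i) p. 11 [cite: MochizukiFrdII2008, Ex 1.3 (i)(ii) p.11]: "If `Π° ⊆ Π` is an
open subgroup, then we shall write `B^temp(Π, Π°) ⊆ B^temp(Π)` for the full subcategory of objects that admit a morphism to
the object `Π/Π°`"; (ii): "Let `φ : Π₁ → Π₂` be an open homomorphism of tempered topological groups [i.e., `φ` is a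
continuous homomorphism, `φ(Π₁)` is an open subgroup of `Π₂`, and `φ` induces an isomorphism of topological groups
`Π₁/Ker(φ) ⥲ φ(Π₁)`]. Then … `φ` induces a natural functor `φ_* : B^temp(Π₁)⁰ → B^temp(Π₂)⁰`"; (iii) pp. 11–12
[cite: MochizukiFrdII2008, Ex 1.3 (iii) pp.11-12]: the composite `B^temp(Π, Π°)⁰ ↪ B^temp(Π)⁰ → B^temp(Q)⁰ ↪ B^temp(G_F)⁰`,
"when `F = ℚ_p`, if we set `D := B^temp(Π, Π°)⁰`, then we obtain a functor `D → D₀ = B^temp(G_{ℚ_p})⁰` [cf. Example 1.1,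
(ii)] which satisfies the hypotheses of Theorem 1.2, (i)". Theorem 2.4 (i), proof p. 20 ll. 9–22
[cite: MochizukiFrdII2008, Thm 2.4 (i) p.20]: "`Φᵢ` is fieldwise saturated if and only if … (a) the inductive limit monoid
`lim_→ Φᵢ(B)` … is divisible. (b) For every pull-back morphism `φ : B → C` of `Cᵢ` that projects to a Galois covering
`φ_D : B_D → C_D` of `Dᵢ`, the injection `O^⊳(C) → O^⊳(B)` … determines a bijection `O^⊳(C) ⥲ O^⊳(B)^{Gal(B/C)}`."

PROOF-ONLY file (abc-iut cell, seat abc-iut-w5-d229; SUBDAG-FrdII-Thm24 row **W12-L01b**, GAP-LEDGER **G-w5d229-1**, the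
GENERAL case; no definitions). `PadicFieldwiseSaturatedGaloisBase.lean` settled the case `Π = G_{ℚ_p}`, `Π° = Π`. Here the
printed base in full generality, typed over LANDED vocabulary only:

* (print's `Π` is the Lean variable `Γ`, the letter `Π` being reserved) `Γ : Type` a topological group with `hΓ : IsTempered Γ` (abc-iut-L3 `IsTempered`), `φ : Π →* GalFbar ℚ_[p]` CONTINUOUS and
  OPEN (`Continuous φ`, `IsOpenMap φ` — an "open homomorphism" of Ex. 1.3 (ii); its image `φ(Π) = G_K` is then an open
  subgroup; surjectivity is NOT assumed);
* `B^temp(Π)⁰` on its small model `CosetCat Π` (objects the open subgroups `U`, standing for `Π/U`; abc-iut-L5-t2/L1-t4) and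
  `B^temp(Π, Π°)⁰` as `P.FullSubcategory` for ANY domination-closed object property `P` of `CosetCat Π`
  (`hP : (X ⟶ Y) → P Y → P X`; "admits a morphism to `Π/Π°`" is such a `P`, by the printed definition);
* the base functor `D → D₀` = `P.ι ⋙ CosetCat.push φ ho ⋙ CosetCat.toConnected (isTempered_galFbar ℚ_[p]) ⋙
  QuasiTemperoid.galoisPadicFields p : P.FullSubcategory ⥤ PadicFld.{0} p` — `φ_*` = abc-iut-L1-t4's `CosetCat.push`
  (`Π/U ↦ G/φ(U)`), the bridge `CosetCat.toConnected` and the valued Galois correspondence `galoisPadicFields`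
  (`G/W ↦ Spec ℚ̄_p^{Stab}`); universe-correct for `PadicFrd.Datum` (everything in `Type 0`).

Over this base, with `Gal f :=` "the open subgroup `U ⊴ Π` of the SOURCE `Π/U` of `f` is normal" (the Galois objects):
* `PadicFrd.temperedBase_hdom` — **`H_dom`**: open normal subgroups of a tempered group are cofinal in the open subgroups
  (`IsTempered.basis`), and the Galois closure `Π/N → Π/U₁` stays in `B^temp(Π, Π°)⁰` (`hP`);
* `PadicFrd.temperedBase_hfix` — **`H_fix`** (Galois theory THROUGH `φ`): for `f : Π/U → Π/V`, `U ⊴ Π`, `f(1·U) = γV`, the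
  endomorphisms of `Π/U` over `Π/V` include the right translations by `γVγ⁻¹`; their `φ_*`-images act on
  `K_{Π/U} = ℚ̄_p^{g₁φ(U)g₁⁻¹}` through `g₁φ(γVγ⁻¹)g₁⁻¹ = Stab(f(x))`, whose fixed field is the image of `K_{Π/V}`
  (`QuasiTemperoid.exists_fieldMap_eq_of_forall_conj`, the `G_{ℚ_p}`-level Galois-theory lemma of `QuasiTemperoidCosetGaloisDescent.lean`);
* `PadicFrd.temperedBase_hram` — **`H_ram`**: over `Π/U`, for `N ≥ 1`, the cover `Π/(U ∩ φ⁻¹N′) → Π/U` with `N′` the (open)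
  normal core of `Stab(α)`, `α^N` a uniformizer of `K_{Π/U}` — `K_{Π/(U ∩ φ⁻¹N′)} ⊇ ℚ̄_p^{N′}` contains every conjugate
  of `α` (`QuasiTemperoid.exists_ordInt_pow_of_le_normalCore`);
* `PadicFrd.Datum.isFieldwiseSaturated_iff_divisible_and_descent_temperedBase` — **the printed equivalence with NO binders**
  for every `p`-adic Frobenioid datum over `B^temp(Π, Π°)⁰ → D₀` (the instance `P := CosetCat.admitsHomTo Π°`, i.e.
  abc-iut-L1-t4's `RelCosetCat Π°`, is spelled out BY NAME in the sequel `PadicFieldwiseSaturatedRelCosetBase.lean`).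

Classical (Galois theory of `ℚ_p`, roots of uniformizers); nothing here bears on [IUTchIII] Cor. 3.12; no statement of the
paper is strengthened.
-/

noncomputable section

open CategoryTheory Opposite Function Topology
open Literature.AnabelianGeometry.SemiGraphs

namespace Literature.AlgebraicGeometry.Frobenioids


/-! ### The printed base `B^temp(Γ, Γ°)⁰ → B^temp(G_{ℚ_p})⁰ → D₀`: the three binders discharged -/

namespace PadicFrd

open QuasiTemperoid

/-- **The normal core of an open subgroup of a compact topological group is open.** [folklore] -/
private theorem isOpen_normalCore' {G : Type} [Group G] [TopologicalSpace G] [IsTopologicalGroup G] [CompactSpace G]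
    (S : Subgroup G) (hS : IsOpen (S : Set G)) : IsOpen (S.normalCore : Set G) := by
  haveI : Finite (G ⧸ S) := Subgroup.quotient_finite_of_isOpen S hS
  haveI : S.FiniteIndex := Subgroup.finiteIndex_of_finite_quotient
  have hclosed : IsClosed (S.normalCore : Set G) := by
    have hset : (S.normalCore : Set G) = ⋂ b : G, (fun a : G => b * a * b⁻¹) ⁻¹' (S : Set G) := by
      ext a
      simp only [SetLike.mem_coe, Set.mem_iInter, Set.mem_preimage]
      exact Iff.rfl
    rw [hset]
    exact isClosed_iInter fun b => (Subgroup.isClosed_of_isOpen S hS).preimage (by fun_prop)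
  exact Subgroup.isOpen_of_isClosed_of_finiteIndex _ hclosed


variable (p : ℕ) [Fact p.Prime] {Γ : Type} [Group Γ] [TopologicalSpace Γ]
  (φ : Γ →* GalFbar ℚ_[p]) (hφ : Continuous φ) (ho : IsOpenMap φ) (hΓ : IsTempered Γ)
  (P : ObjectProperty (CosetCat Γ)) (hP : ∀ {X Y : CosetCat Γ}, (X ⟶ Y) → P Y → P X)

include hΓ hP in
/-- **`H_dom` over `B^temp(Γ, Γ°)⁰ → D₀`** in EXACTLY the binder shape `hdom` of
`PadicFrd.Datum.isFieldwiseSaturated_iff_divisible_and_descent`, with `Gal f :=` "the open subgroup of the source of `f`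
is normal in `Γ`": every `Γ/U₁` in `B^temp(Γ, Γ°)⁰` is dominated by a Galois `Γ/N → Γ/U₁`, `N ⊆ U₁` open normal (`Γ` is
TEMPERED: open normal subgroups are cofinal, [SemiAnbd] Def. 3.1 (i)), which again lies in `B^temp(Γ, Γ°)⁰`.
[cite: MochizukiFrdII2008, Thm 2.4 (i) p.20] -/
theorem temperedBase_hdom ⦃B₁ C : P.FullSubcategory⦄ (_f₁ : B₁ ⟶ C) :
    ∃ (B : P.FullSubcategory) (_g : B ⟶ B₁), B.obj.sg.toSubgroup.Normal := by
  obtain ⟨N, -, hN⟩ := hΓ.basis (B₁.obj.sg : Set Γ) (B₁.obj.sg.isOpen.mem_nhds B₁.obj.sg.one_mem)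
  let g : (⟨N.toOpenSubgroup⟩ : CosetCat Γ) ⟶ B₁.obj :=
    CosetCat.homMk ((1 : Γ) : B₁.obj.carrier) fun u hu => (CosetCat.smul_one_eq_one_iff _ u).mpr (hN hu)
  refine ⟨⟨⟨N.toOpenSubgroup⟩, hP g B₁.property⟩, ObjectProperty.homMk g, ?_⟩
  change N.toOpenSubgroup.toSubgroup.Normal
  exact N.isNormal'

/-- For `U ⊴ Γ` open and `t ∈ Γ`, the coset `tU` is `U`-fixed, so the right translation `Γ/U → Γ/U`, `πU ↦ πtU`, is a
morphism of the coset category (its point is `tU`). [cite: MochizukiFrdII2008, Ex 1.3 (i)(ii) p.11] -/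
private theorem smul_coe_eq_coe_of_normal (X : CosetCat Γ) (hX : X.sg.toSubgroup.Normal) (t : Γ) :
    ∀ u ∈ X.sg, u • ((t : Γ) : X.carrier) = ((t : Γ) : X.carrier) := by
  intro u hu
  rw [MulAction.Quotient.smul_coe, smul_eq_mul, QuotientGroup.eq, show (u * t)⁻¹ * t = t⁻¹ * u⁻¹ * t⁻¹⁻¹ by group]
  exact hX.conj_mem _ (inv_mem hu) _

/-- **`H_fix` over `B^temp(Γ, Γ°)⁰ → D₀`** in EXACTLY the binder shape `hfix` (Galois theory through `φ`): for
`f : Γ/U → Γ/V` with `U ⊴ Γ`, an element of `K_{Γ/U}` fixed by the field maps of all endomorphisms of `Γ/U` over `Γ/V` is the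
image of an element of `K_{Γ/V}` — the right translations by `γVγ⁻¹` (`f(1·U) = γV`) are such endomorphisms and their
`φ_*`-images act on `K_{Γ/U} = ℚ̄_p^{g₁φ(U)g₁⁻¹}` through `g₁ φ(γ) φ(V) φ(γ)⁻¹ g₁⁻¹`.
[cite: MochizukiFrdII2008, Thm 2.4 (i) p.20] -/
theorem temperedBase_hfix ⦃B C : P.FullSubcategory⦄ (f : B ⟶ C) (hGal : B.obj.sg.toSubgroup.Normal)
    (x : ((P.ι ⋙ CosetCat.push φ ho ⋙ CosetCat.toConnected (isTempered_galFbar ℚ_[p]) ⋙ galoisPadicFields p).obj B).K)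
    (hx : ∀ σ : B ⟶ B, σ ≫ f = f →
      ((P.ι ⋙ CosetCat.push φ ho ⋙ CosetCat.toConnected (isTempered_galFbar ℚ_[p]) ⋙ galoisPadicFields p).map σ).alg x
        = x) :
    ∃ x₀ : ((P.ι ⋙ CosetCat.push φ ho ⋙ CosetCat.toConnected (isTempered_galFbar ℚ_[p]) ⋙ galoisPadicFields p).obj C).K,
      ((P.ι ⋙ CosetCat.push φ ho ⋙ CosetCat.toConnected (isTempered_galFbar ℚ_[p]) ⋙ galoisPadicFields p).map f).alg x₀
        = x := by
  -- representatives: `f(1·U) = γV`, base point of `G/φ(U)` = `g₁φ(U)`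
  obtain ⟨γ, hγ⟩ := QuotientGroup.mk_surjective (CosetCat.pt f.hom)
  obtain ⟨g₁, hg₁⟩ := QuotientGroup.mk_surjective
    (basePt ((CosetCat.toConnected (isTempered_galFbar ℚ_[p])).obj ((CosetCat.push φ ho).obj B.obj)) :
      ((CosetCat.push φ ho).obj B.obj).carrier)
  -- the point of `φ_* f` is `φ(γ)·φ(V)`
  have hc : ((φ γ : GalFbar ℚ_[p]) : ((CosetCat.push φ ho).obj C.obj).carrier) =
      CosetCat.pt ((CosetCat.push φ ho).map f.hom) := by
    rw [CosetCat.pt_push_map, ← hγ]; rfl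
  refine exists_fieldMap_eq_of_forall_conj p ((CosetCat.push φ ho).map f.hom) hc hg₁ x fun w hw => ?_
  -- `w = φ v`, `v ∈ V`; the right translation by `γ v γ⁻¹` is an endomorphism of `Γ/U` over `Γ/V`
  obtain ⟨v, hv, rfl⟩ := (CosetCat.mem_mapOpen φ ho).mp hw
  let σ₀ : B.obj ⟶ B.obj :=
    CosetCat.homMk ((γ * v * γ⁻¹ : Γ) : B.obj.carrier) (smul_coe_eq_coe_of_normal B.obj hGal _)
  have hσ₀ : CosetCat.pt σ₀ = ((γ * v * γ⁻¹ : Γ) : B.obj.carrier) := CosetCat.pt_homMk _ _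
  have hσf : (ObjectProperty.homMk σ₀ : B ⟶ B) ≫ f = f := by
    apply ObjectProperty.hom_ext
    change σ₀ ≫ f.hom = f.hom
    apply CosetCat.hom_ext
    rw [CosetCat.pt_comp, hσ₀, CosetCat.toFun_coe, ← hγ, MulAction.Quotient.smul_coe, smul_eq_mul, QuotientGroup.eq,
      show (γ * v * γ⁻¹ * γ)⁻¹ * γ = v⁻¹ by group]
    exact inv_mem hv
  -- its field map fixes `x`; that field map is `a ↦ h' a` with `h' · g₁φ(U) = g₁ φ(γvγ⁻¹) φ(U)`
  have h1 : (fieldMap ((CosetCat.toConnected (isTempered_galFbar ℚ_[p])).map ((CosetCat.push φ ho).map σ₀)) x :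
      Fbar ℚ_[p]) = Subtype.val x := congrArg Subtype.val (hx _ hσf)
  have hc' : ((φ (γ * v * γ⁻¹) : GalFbar ℚ_[p]) : ((CosetCat.push φ ho).obj B.obj).carrier) =
      CosetCat.pt ((CosetCat.push φ ho).map σ₀) := by
    rw [CosetCat.pt_push_map, hσ₀]; rfl
  have hh := carrier_spec ((CosetCat.toConnected (isTempered_galFbar ℚ_[p])).map ((CosetCat.push φ ho).map σ₀))
  rw [← hg₁, ptMap_toConnected_map_mk p _ hc' g₁] at hh
  change carrier ((CosetCat.toConnected (isTempered_galFbar ℚ_[p])).map ((CosetCat.push φ ho).map σ₀)) •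
      (g₁ : ((CosetCat.push φ ho).obj B.obj).carrier) =
    ((g₁ * φ (γ * v * γ⁻¹) : GalFbar ℚ_[p]) : ((CosetCat.push φ ho).obj B.obj).carrier) at hh
  rw [MulAction.Quotient.smul_coe, smul_eq_mul, QuotientGroup.eq] at hh
  -- `u₀ := (h' g₁)⁻¹ (g₁ φ(γvγ⁻¹)) ∈ φ(U)`; `x ∈ K_{Γ/U}` is fixed by `g₁ u₀ g₁⁻¹` and by `h'`, and
  -- `g₁ φ(γ v γ⁻¹) g₁⁻¹ = h' (g₁ u₀ g₁⁻¹)`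
  rw [fieldMap_apply_of_ρ_eq _ (carrier_spec _)] at h1
  have h2 := ((mem_fixFld_toConnected_iff p _ hg₁ (Subtype.val x)).mp x.2) _ hh
  have h3 : (g₁ * (φ γ * φ v * (φ γ)⁻¹) * g₁⁻¹) (Subtype.val x) =
      (carrier ((CosetCat.toConnected (isTempered_galFbar ℚ_[p])).map ((CosetCat.push φ ho).map σ₀)) *
        (g₁ * ((carrier ((CosetCat.toConnected (isTempered_galFbar ℚ_[p])).map ((CosetCat.push φ ho).map σ₀)) * g₁)⁻¹ *
          (g₁ * φ (γ * v * γ⁻¹))) * g₁⁻¹)) (Subtype.val x) := by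
    congr 1
    rw [map_mul, map_mul, map_inv]
    group
  rw [h3, AlgEquiv.mul_apply, h2, h1]

include hφ hP in
/-- **`H_ram` over `B^temp(Γ, Γ°)⁰ → D₀`** in EXACTLY the binder shape `hram`: over every `Γ/U` and for every `N ≥ 1` the cover
`Γ/(U ∩ φ⁻¹N′) → Γ/U` — `N′` the open normal core of `Stab(α)`, `α^N` a uniformizer of `K_{Γ/U}` — makes every class of
`ord(O^⊳_{K_{Γ/U}})` an `N`-th power; it lies in `B^temp(Γ, Γ°)⁰` (domination-closed). [cite: MochizukiFrdII2008, Thm 2.4 (i) p.20] -/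
theorem temperedBase_hram (C : P.FullSubcategory) (N : ℕ) (hN : 0 < N) :
    ∃ (B : P.FullSubcategory) (f : B ⟶ C),
      ∀ a : OrdInt ((P.ι ⋙ CosetCat.push φ ho ⋙ CosetCat.toConnected (isTempered_galFbar ℚ_[p]) ⋙
          galoisPadicFields p).obj C).K,
        ∃ b : OrdInt ((P.ι ⋙ CosetCat.push φ ho ⋙ CosetCat.toConnected (isTempered_galFbar ℚ_[p]) ⋙
            galoisPadicFields p).obj B).K,
          ordIntMapOfHom
              ((P.ι ⋙ CosetCat.push φ ho ⋙ CosetCat.toConnected (isTempered_galFbar ℚ_[p]) ⋙ galoisPadicFields p).map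
                f).alg
              ((P.ι ⋙ CosetCat.push φ ho ⋙ CosetCat.toConnected (isTempered_galFbar ℚ_[p]) ⋙ galoisPadicFields p).map
                f).isValHom a
            = b ^ N := by
  classical
  haveI : IsGalois ℚ_[p] (Fbar ℚ_[p]) := {}
  -- a uniformizer `π` of `K_{Γ/U}` and an `N`-th root `α`
  obtain ⟨π, -, hπ⟩ := exists_uniformizer_galoisPadicFields p
    ((CosetCat.toConnected (isTempered_galFbar ℚ_[p])).obj ((CosetCat.push φ ho).obj C.obj))
  have hπmem := (mem_intNonzero_galoisPadicFields_iff p _ π.1).mp π.2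
  obtain ⟨α, hα⟩ := IsAlgClosed.exists_pow_nat_eq (Subtype.val π.1 : Fbar ℚ_[p]) hN
  -- the open normal core `N′` of `Stab(α)` and the cover `Γ/(U ∩ φ⁻¹ N′) → Γ/U`
  have hN'open : IsOpen ((MulAction.stabilizer (GalFbar ℚ_[p]) α).normalCore : Set (GalFbar ℚ_[p])) :=
    isOpen_normalCore' _ (isOpen_stabilizer_elem p α)
  let N' : OpenSubgroup (GalFbar ℚ_[p]) := ⟨(MulAction.stabilizer (GalFbar ℚ_[p]) α).normalCore, hN'open⟩
  let B₀ : CosetCat Γ := ⟨C.obj.sg ⊓ N'.comap φ hφ⟩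
  let f₀ : B₀ ⟶ C.obj := CosetCat.homMk ((1 : Γ) : C.obj.carrier) fun u hu =>
    (CosetCat.smul_one_eq_one_iff _ u).mpr (OpenSubgroup.mem_inf.mp hu).1
  refine ⟨⟨B₀, hP f₀ C.property⟩, ObjectProperty.homMk f₀, fun a => ?_⟩
  -- `φ(U ∩ φ⁻¹N′) ⊆ N′`
  have hW₁ : (CosetCat.mapOpen φ ho B₀.sg).toSubgroup ≤ (MulAction.stabilizer (GalFbar ℚ_[p]) α).normalCore := by
    intro g hg
    obtain ⟨u, hu, rfl⟩ := (CosetCat.mem_mapOpen φ ho).mp hg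
    exact OpenSubgroup.mem_comap.mp (OpenSubgroup.mem_inf.mp hu).2
  obtain ⟨β, hβ⟩ := exists_ordIntMapOfHom_eq_pow_of_le_normalCore p ((CosetCat.push φ ho).map f₀) hN hW₁ π hα
  obtain ⟨k, rfl⟩ := hπ a
  refine ⟨Associates.mk β ^ k, ?_⟩
  change ordIntMapOfHom ((galoisPadicFields p).map ((CosetCat.toConnected (isTempered_galFbar ℚ_[p])).map
      ((CosetCat.push φ ho).map f₀))).alg ((galoisPadicFields p).map ((CosetCat.toConnected (isTempered_galFbar ℚ_[p])).map
      ((CosetCat.push φ ho).map f₀))).isValHom (Associates.mk π ^ k) = (Associates.mk β ^ k) ^ N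
  exact ((map_pow _ _ _).trans (congrArg (fun z => z ^ k) hβ)).trans (pow_right_comm _ _ _)

namespace Datum

include hφ hΓ hP in
/-- **[FrdII] Thm. 2.4 (i), proof p. 20 ll. 9–22: «`Φ` is fieldwise saturated if and only if (a) and (b) hold» —
UNCONDITIONAL for every `p`-adic Frobenioid datum `(Φ, B, Div_B)` over the printed base
`D = B^temp(Π, Π°)⁰ → B^temp(G_{ℚ_p})⁰ → D₀`** (§2 p. 17: `Π` (here `Γ`) tempered, `Π → G_{ℚ_p}` an open homomorphism,
`Π° ⊆ Π` open; on the small models `CosetCat`, `P` = "admits a morphism to `Π/Π°`" or any domination-closed property).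
(a) = every element of every `Φ(C)` acquires an `n`-th root in some `Φ(B)`, `B → C`; (b) = for `f : Γ/U → Γ/V` with
`U ⊴ Γ` ("Galois covering"), every effective `b ∈ B(Γ/U)` fixed by all `B(σ)`, `σ` over `Γ/V`, is `B(f) c` with
`c ∈ B(Γ/V)` effective. [cite: MochizukiFrdII2008, Thm 2.4 (i) p.20] -/
theorem isFieldwiseSaturated_iff_divisible_and_descent_temperedBase (d : Datum P.FullSubcategory p)
    (hd : d.base = P.ι ⋙ CosetCat.push φ ho ⋙ CosetCat.toConnected (isTempered_galFbar ℚ_[p]) ⋙ galoisPadicFields p) :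
    d.IsFieldwiseSaturated ↔
      (∀ (C : P.FullSubcategory) (x : d.Φ.obj (op C)) (n : ℕ), 0 < n →
          ∃ (B : P.FullSubcategory) (f : B ⟶ C) (y : d.Φ.obj (op B)), y ^ n = (d.Φ.map f.op).hom x) ∧
        (∀ ⦃B C : P.FullSubcategory⦄ (f : B ⟶ C), B.obj.sg.toSubgroup.Normal → ∀ b : d.B.obj (op B),
          (∃ y : d.Φ.obj (op B), Frobenioids.divB d.Φ d.B d.divB (op B) b = Algebra.GrothendieckGroup.of y) →
          (∀ σ : B ⟶ B, σ ≫ f = f → (d.B.map σ.op).hom b = b) →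
          ∃ c : d.B.obj (op C),
            (∃ z : d.Φ.obj (op C), Frobenioids.divB d.Φ d.B d.divB (op C) c = Algebra.GrothendieckGroup.of z) ∧
            (d.B.map f.op).hom c = b) := by
  obtain ⟨base, hloc, hc, he, Φ, ι, hι, hmono, B, toB0, divB, sq, cart, nz⟩ := d
  cases hd
  exact isFieldwiseSaturated_iff_divisible_and_descent _
    (fun ⦃B C : P.FullSubcategory⦄ (_ : B ⟶ C) => B.obj.sg.toSubgroup.Normal)
    (temperedBase_hdom hΓ P hP) (temperedBase_hfix p φ ho P) (temperedBase_hram p φ hφ ho P hP)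

include hφ hΓ hP in
/-- The forward direction as used downstream ([FrdII] Thm. 2.4 (ii), p. 20 l. −5): over `B^temp(Π, Π°)⁰ → D₀`, a fieldwise
saturated datum satisfies (a) and (b). [cite: MochizukiFrdII2008, Thm 2.4 (i) p.20] -/
theorem divisible_and_descent_of_isFieldwiseSaturated_temperedBase (d : Datum P.FullSubcategory p)
    (hd : d.base = P.ι ⋙ CosetCat.push φ ho ⋙ CosetCat.toConnected (isTempered_galFbar ℚ_[p]) ⋙ galoisPadicFields p)
    (hfs : d.IsFieldwiseSaturated) :
    (∀ (C : P.FullSubcategory) (x : d.Φ.obj (op C)) (n : ℕ), 0 < n →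
        ∃ (B : P.FullSubcategory) (f : B ⟶ C) (y : d.Φ.obj (op B)), y ^ n = (d.Φ.map f.op).hom x) ∧
      (∀ ⦃B C : P.FullSubcategory⦄ (f : B ⟶ C), B.obj.sg.toSubgroup.Normal → ∀ b : d.B.obj (op B),
        (∃ y : d.Φ.obj (op B), Frobenioids.divB d.Φ d.B d.divB (op B) b = Algebra.GrothendieckGroup.of y) →
        (∀ σ : B ⟶ B, σ ≫ f = f → (d.B.map σ.op).hom b = b) →
        ∃ c : d.B.obj (op C),
          (∃ z : d.Φ.obj (op C), Frobenioids.divB d.Φ d.B d.divB (op C) c = Algebra.GrothendieckGroup.of z) ∧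
          (d.B.map f.op).hom c = b) :=
  (isFieldwiseSaturated_iff_divisible_and_descent_temperedBase p φ hφ ho hΓ P hP d hd).mp hfs

end Datum

end PadicFrd

end Literature.AlgebraicGeometry.Frobenioids

end
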